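import Mathlib
import Literature.Analysis.SpecialFunctions.BesselJZeroFermiIntegral
import Literature.Analysis.InverseSpectral.StieltjesInversion
import Summits.AtomisticToContinuum.FouriersLaw.Theses.EmbeddedDrudeMourre
import Summits.AtomisticToContinuum.FouriersLaw.Theses.LatticeLandauDamping
import HarnessLib

/-!
# `EmbeddedDrudeMourre.AbelOfSpectralDensity` — the Poisson-kernel (Abel) lemma, proved

Item `stmt-AtomisticToContinuum-12598` (support, route `EmbeddedDrudeMourre`, sub-problem
`FouriersLaw`; the same statement verbatim is the support `AbelOfSpectralDensity` of route
`LatticeLandauDamping`). Statement: if `σ` is a finite measure on `ℝ`, `C(t) = ∫ cos(ωt) dσ(ω)`, and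
on the window `(-δ, δ)` the measure `σ` has a continuous non-negative density `g` with respect to
Lebesgue measure, then the Abel means of `C` converge:

  `∫_{t>0} e^{-νt} C(t) dt → π g(0)`  as `ν ↓ 0`.

Proof (folklore; pure real analysis):
1. `integral_exp_neg_mul_cosTransform` — Fubini and the Laplace transform of the cosine
   (`Literature.Analysis.SpecialFunctions.integral_exp_neg_mul_cos`):
   `∫_{t>0} e^{-νt} C(t) dt = ∫ ν/(ν²+ω²) dσ(ω)` for `ν > 0`.
2. `norm_setIntegral_poisson_compl_le` — the part `|ω| ≥ δ` is at most `(ν/δ²)·σ(ℝ)`.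
3. `setIntegral_eq_of_restrict_eq_withDensity`, `integrableOn_of_restrict_eq_withDensity` — on the
   window the `σ`-integral is the Lebesgue integral against `g`, and `g ∈ L¹(-δ, δ)` because `σ` is
   finite.
4. `tendsto_setIntegral_poisson_mul` — the Poisson kernel `ν/(ν²+ω²)` is an approximate identity of
   mass `π` (`Literature.Analysis.InverseSpectral.integral_poissonKernel`, tail
   `Literature.Analysis.InverseSpectral.integral_tail_div_sq`): for `g` continuous on `(-δ, δ)` and
   integrable there, `∫_{(-δ,δ)} ν/(ν²+ω²) g(ω) dω → π g(0)`.
The closing theorem is `abelOfSpectralDensity_proof`; `latticeLandauDamping_abelOfSpectralDensity_proof`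
is the byte-identical twin decl of route `LatticeLandauDamping` (same item), by definitional unfolding.
-/

noncomputable section

open MeasureTheory Filter Set Topology
open scoped NNReal ENNReal

namespace Summit.AtomisticToContinuum.FouriersLaw.Theorems.AbelOfSpectralDensity

/-! ### 1. Fubini: the Abel mean of the cosine transform is the Poisson integral of `σ` -/

/-- For a finite measure `σ` on `ℝ` and `ν > 0`,
`∫_{t>0} e^{-νt} (∫ cos(ωt) dσ(ω)) dt = ∫ ν/(ν²+ω²) dσ(ω)` (Fubini; the integrand is dominated by
`e^{-νt}`, and `∫₀^∞ e^{-νt} cos(ωt) dt = ν/(ν²+ω²)`). [folklore] -/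
theorem integral_exp_neg_mul_cosTransform (σ : Measure ℝ) [IsFiniteMeasure σ] {ν : ℝ}
    (hν : 0 < ν) :
    ∫ t in Ioi (0:ℝ), Real.exp (-(ν * t)) * ∫ ω, Real.cos (ω * t) ∂σ =
      ∫ ω, ν / (ν ^ 2 + ω ^ 2) ∂σ := by
  have hint : Integrable (Function.uncurry fun (t ω : ℝ) => Real.exp (-(ν * t)) * Real.cos (ω * t))
      ((volume.restrict (Ioi (0:ℝ))).prod σ) := by
    simp only [Function.uncurry_def]
    have hexp : Integrable (fun t : ℝ => Real.exp (-(ν * t))) (volume.restrict (Ioi (0:ℝ))) := by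
      have h := exp_neg_integrableOn_Ioi 0 hν
      refine h.congr_fun (fun t _ => ?_) measurableSet_Ioi
      simp only [neg_mul]
    have hone : Integrable (fun _ : ℝ => (1:ℝ)) σ := integrable_const 1
    have h1 : Integrable (fun z : ℝ × ℝ => Real.exp (-(ν * z.1)) * (1 : ℝ))
        ((volume.restrict (Ioi (0:ℝ))).prod σ) := hexp.mul_prod hone
    refine h1.mono' (Continuous.aestronglyMeasurable (by fun_prop)) (ae_of_all _ (fun z => ?_))
    rw [norm_mul, Real.norm_eq_abs, Real.norm_eq_abs, Real.abs_exp, mul_one]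
    exact mul_le_of_le_one_right (Real.exp_pos _).le (Real.abs_cos_le_one _)
  calc ∫ t in Ioi (0:ℝ), Real.exp (-(ν * t)) * ∫ ω, Real.cos (ω * t) ∂σ
      = ∫ t in Ioi (0:ℝ), ∫ ω, Real.exp (-(ν * t)) * Real.cos (ω * t) ∂σ := by
        refine setIntegral_congr_fun measurableSet_Ioi (fun t _ => ?_)
        exact (integral_const_mul _ _).symm
    _ = ∫ ω, (∫ t in Ioi (0:ℝ), Real.exp (-(ν * t)) * Real.cos (ω * t)) ∂σ :=
        integral_integral_swap hint
    _ = ∫ ω, ν / (ν ^ 2 + ω ^ 2) ∂σ := by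
        refine integral_congr_ae (ae_of_all _ (fun ω => ?_))
        exact Literature.Analysis.SpecialFunctions.integral_exp_neg_mul_cos hν ω

/-! ### 2. The tail `|ω| ≥ δ` -/

/-- Outside the window the Poisson kernel is at most `ν/δ²`, so
`‖∫_{(-δ,δ)ᶜ} ν/(ν²+ω²) dσ(ω)‖ ≤ (ν/δ²)·σ(ℝ)`. [folklore] -/
theorem norm_setIntegral_poisson_compl_le (σ : Measure ℝ) [IsFiniteMeasure σ] {δ ν : ℝ}
    (hδ : 0 < δ) (hν : 0 ≤ ν) :
    ‖∫ ω in (Ioo (-δ) δ)ᶜ, ν / (ν ^ 2 + ω ^ 2) ∂σ‖ ≤ ν / δ ^ 2 * σ.real univ := by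
  calc ‖∫ ω in (Ioo (-δ) δ)ᶜ, ν / (ν ^ 2 + ω ^ 2) ∂σ‖ ≤ ν / δ ^ 2 * σ.real (Ioo (-δ) δ)ᶜ := by
        refine norm_setIntegral_le_of_norm_le_const (measure_lt_top σ _) (fun ω hω => ?_)
        rw [Real.norm_eq_abs, abs_of_nonneg (by positivity)]
        have hω : δ ≤ |ω| := by
          simp only [mem_compl_iff, mem_Ioo, not_and_or, not_lt] at hω
          rcases hω with h | h
          · rw [le_abs]; right; linarith
          · rw [le_abs]; left; exact h
        have hδω : δ ^ 2 ≤ ω ^ 2 := by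
          calc δ ^ 2 ≤ |ω| ^ 2 := pow_le_pow_left₀ hδ.le hω 2
            _ = ω ^ 2 := sq_abs ω
        have hω2 : 0 < ω ^ 2 := lt_of_lt_of_le (by positivity) hδω
        calc ν / (ν ^ 2 + ω ^ 2) ≤ ν / ω ^ 2 :=
              div_le_div_of_nonneg_left hν hω2 (by nlinarith)
          _ ≤ ν / δ ^ 2 := div_le_div_of_nonneg_left hν (by positivity) hδω
    _ ≤ ν / δ ^ 2 * σ.real univ :=
        mul_le_mul_of_nonneg_left (measureReal_mono (subset_univ _)) (by positivity)

/-! ### 3. The window: density and integrability -/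

/-- If `σ` restricted to `(-δ, δ)` is Lebesgue measure with density `g ≥ 0` (`g` a.e.-measurable
there), then `σ`-integrals over the window are Lebesgue integrals against `g`. [folklore] -/
theorem setIntegral_eq_of_restrict_eq_withDensity {σ : Measure ℝ} {δ : ℝ} {g : ℝ → ℝ}
    (hg0 : ∀ ω ∈ Ioo (-δ) δ, 0 ≤ g ω)
    (hgm : AEMeasurable g (volume.restrict (Ioo (-δ) δ)))
    (hσ : σ.restrict (Ioo (-δ) δ) =
      (volume.restrict (Ioo (-δ) δ)).withDensity (fun ω => ENNReal.ofReal (g ω)))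
    (f : ℝ → ℝ) :
    ∫ ω in Ioo (-δ) δ, f ω ∂σ = ∫ ω in Ioo (-δ) δ, f ω * g ω := by
  rw [hσ]
  have : (fun ω => ENNReal.ofReal (g ω)) = fun ω => ((fun ω => (g ω).toNNReal) ω : ℝ≥0∞) := rfl
  rw [this, integral_withDensity_eq_integral_smul₀ hgm.real_toNNReal]
  refine setIntegral_congr_fun measurableSet_Ioo (fun ω hω => ?_)
  simp only [NNReal.smul_def, smul_eq_mul, Real.coe_toNNReal _ (hg0 ω hω), mul_comm (g ω)]

/-- If the finite measure `σ` restricted to `(-δ, δ)` is Lebesgue measure with a continuous density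
`g ≥ 0`, then `g` is integrable on `(-δ, δ)` (its integral is `σ((-δ, δ)) < ∞`). [folklore] -/
theorem integrableOn_of_restrict_eq_withDensity {σ : Measure ℝ} [IsFiniteMeasure σ] {δ : ℝ}
    {g : ℝ → ℝ} (hgc : ContinuousOn g (Ioo (-δ) δ)) (hg0 : ∀ ω ∈ Ioo (-δ) δ, 0 ≤ g ω)
    (hσ : σ.restrict (Ioo (-δ) δ) =
      (volume.restrict (Ioo (-δ) δ)).withDensity (fun ω => ENNReal.ofReal (g ω))) :
    IntegrableOn g (Ioo (-δ) δ) := by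
  have hgm : AEStronglyMeasurable g (volume.restrict (Ioo (-δ) δ)) :=
    hgc.aestronglyMeasurable measurableSet_Ioo
  refine ⟨hgm, ?_⟩
  have h1 : ∫⁻ ω in Ioo (-δ) δ, ENNReal.ofReal (g ω) = σ (Ioo (-δ) δ) := by
    have h := congrArg (fun μ : Measure ℝ => μ univ) hσ
    simp only [Measure.restrict_apply_univ, withDensity_apply _ MeasurableSet.univ,
      Measure.restrict_univ] at h
    exact h.symm
  unfold HasFiniteIntegral
  calc ∫⁻ ω in Ioo (-δ) δ, ‖g ω‖ₑ = ∫⁻ ω in Ioo (-δ) δ, ENNReal.ofReal (g ω) := by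
        refine setLIntegral_congr_fun measurableSet_Ioo (fun ω hω => ?_)
        exact Real.enorm_eq_ofReal (hg0 ω hω)
    _ = σ (Ioo (-δ) δ) := h1
    _ < ⊤ := measure_lt_top σ _

/-! ### 4. The Poisson kernel is an approximate identity on the window -/

/-- The Poisson kernel `ω ↦ ν/(ν²+ω²)` (`ν > 0`) is integrable on `ℝ` with integral `π`.
[folklore] -/
theorem integrable_poisson_and_integral_eq_pi {ν : ℝ} (hν : 0 < ν) :
    Integrable (fun ω : ℝ => ν / (ν ^ 2 + ω ^ 2)) ∧ ∫ ω : ℝ, ν / (ν ^ 2 + ω ^ 2) = Real.pi := by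
  have hfun : (fun x : ℝ => ν / ((0 - x) ^ 2 + ν ^ 2)) = fun ω : ℝ => ν / (ν ^ 2 + ω ^ 2) := by
    funext x
    ring_nf
  refine ⟨?_, ?_⟩
  · have h := Literature.Analysis.InverseSpectral.integrable_poissonKernel hν 0
    rwa [hfun] at h
  · have h := Literature.Analysis.InverseSpectral.integral_poissonKernel hν 0
    rwa [hfun] at h

/-- The tail of the Poisson kernel outside the window: `0 ≤ ∫_{(-δ,δ)ᶜ} ν/(ν²+ω²) dω ≤ 2ν/δ`.
[folklore] -/
theorem setIntegral_poisson_compl_le {δ ν : ℝ} (hδ : 0 < δ) (hν : 0 < ν) :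
    0 ≤ ∫ ω in (Ioo (-δ) δ)ᶜ, ν / (ν ^ 2 + ω ^ 2) ∧
      ∫ ω in (Ioo (-δ) δ)ᶜ, ν / (ν ^ 2 + ω ^ 2) ≤ 2 * ν / δ := by
  have hset : (Ioo (-δ) δ)ᶜ = {u : ℝ | δ ≤ |u|} := by
    ext u
    simp only [mem_compl_iff, mem_Ioo, not_and_or, not_lt, mem_setOf_eq, le_abs]
    constructor
    · rintro (h | h)
      · right; linarith
      · left; exact h
    · rintro (h | h)
      · right; exact h
      · left; linarith
  obtain ⟨htint, htval⟩ := Literature.Analysis.InverseSpectral.integral_tail_div_sq hδ ν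
  have hmeas : MeasurableSet {u : ℝ | δ ≤ |u|} :=
    measurableSet_le measurable_const continuous_abs.measurable
  refine ⟨setIntegral_nonneg (MeasurableSet.compl measurableSet_Ioo) (fun ω _ => by positivity),
    ?_⟩
  rw [hset, ← htval]
  refine setIntegral_mono_on (integrable_poisson_and_integral_eq_pi hν).1.integrableOn htint hmeas
    (fun ω hω => ?_)
  simp only [mem_setOf_eq] at hω
  have hω2 : 0 < ω ^ 2 := by
    have : δ ^ 2 ≤ ω ^ 2 := by
      calc δ ^ 2 ≤ |ω| ^ 2 := pow_le_pow_left₀ hδ.le hω 2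
        _ = ω ^ 2 := sq_abs ω
    exact lt_of_lt_of_le (by positivity) this
  exact div_le_div_of_nonneg_left hν.le hω2 (by nlinarith)

/-- **Core estimate.** For `δ, η, ν > 0`, `e ≥ 0`, `g` integrable on `(-δ, δ)` with
`|g(ω) - g(0)| ≤ e` for `|ω| < η`:
`|∫_{(-δ,δ)} ν/(ν²+ω²) g(ω) dω - π g(0)| ≤ π e + (ν/η²) ∫_{(-δ,δ)} |g - g(0)| + |g(0)|·(2ν/δ)`.
[folklore] -/
theorem abs_setIntegral_poisson_mul_sub_le {δ η ν e : ℝ} (hδ : 0 < δ) (hη : 0 < η)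
    (hν : 0 < ν) (he : 0 ≤ e) {g : ℝ → ℝ} (hgi : IntegrableOn g (Ioo (-δ) δ))
    (hge : ∀ ω, |ω| < η → |g ω - g 0| ≤ e) :
    |(∫ ω in Ioo (-δ) δ, ν / (ν ^ 2 + ω ^ 2) * g ω) - Real.pi * g 0| ≤
      Real.pi * e + ν / η ^ 2 * (∫ ω in Ioo (-δ) δ, |g ω - g 0|) + |g 0| * (2 * ν / δ) := by
  set P : ℝ → ℝ := fun ω => ν / (ν ^ 2 + ω ^ 2) with hP
  obtain ⟨hPint, hPtot⟩ := integrable_poisson_and_integral_eq_pi hν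
  have hPpos : ∀ ω, 0 ≤ P ω := fun ω => by positivity
  have hPc : Continuous P := by
    refine continuous_const.div (by fun_prop) (fun ω => ?_)
    positivity
  have hPle : ∀ ω, P ω ≤ 1 / ν := fun ω => by
    simp only [hP]
    rw [div_le_div_iff₀ (by positivity) hν, one_mul]
    nlinarith [sq_nonneg ω]
  -- integrability facts on the window
  have hS : volume (Ioo (-δ) δ) ≠ ∞ := by
    rw [Real.volume_Ioo]; exact ENNReal.ofReal_ne_top
  have hconst : IntegrableOn (fun _ : ℝ => g 0) (Ioo (-δ) δ) := integrableOn_const hS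
  have hdiff : IntegrableOn (fun ω => g ω - g 0) (Ioo (-δ) δ) := hgi.sub hconst
  have hPg : IntegrableOn (fun ω => P ω * g ω) (Ioo (-δ) δ) :=
    Integrable.bdd_mul hgi hPc.aestronglyMeasurable (ae_of_all _ (fun ω => by
      rw [Real.norm_eq_abs, abs_of_nonneg (hPpos ω)]; exact hPle ω))
  have hPd : IntegrableOn (fun ω => P ω * (g ω - g 0)) (Ioo (-δ) δ) :=
    Integrable.bdd_mul hdiff hPc.aestronglyMeasurable (ae_of_all _ (fun ω => by
      rw [Real.norm_eq_abs, abs_of_nonneg (hPpos ω)]; exact hPle ω))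
  -- algebraic decomposition
  have hdecomp : (∫ ω in Ioo (-δ) δ, P ω * g ω) - Real.pi * g 0 =
      (∫ ω in Ioo (-δ) δ, P ω * (g ω - g 0)) - g 0 * ∫ ω in (Ioo (-δ) δ)ᶜ, P ω := by
    have h1 : ∫ ω in Ioo (-δ) δ, P ω * (g ω - g 0) =
        (∫ ω in Ioo (-δ) δ, P ω * g ω) - g 0 * ∫ ω in Ioo (-δ) δ, P ω := by
      rw [← integral_const_mul, ← integral_sub hPg (hPint.integrableOn.const_mul _)]
      exact integral_congr_ae (ae_of_all _ (fun ω => by ring))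
    have h2 : ∫ ω in Ioo (-δ) δ, P ω = Real.pi - ∫ ω in (Ioo (-δ) δ)ᶜ, P ω := by
      rw [← hPtot, ← integral_add_compl measurableSet_Ioo hPint]
      ring
    rw [h1, h2]
    ring
  -- near part
  have hnear : |∫ ω in Ioo (-δ) δ ∩ Metric.ball 0 η, P ω * (g ω - g 0)| ≤ Real.pi * e := by
    have hs : MeasurableSet (Ioo (-δ) δ ∩ Metric.ball 0 η) :=
      measurableSet_Ioo.inter measurableSet_ball
    calc |∫ ω in Ioo (-δ) δ ∩ Metric.ball 0 η, P ω * (g ω - g 0)|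
        ≤ ∫ ω in Ioo (-δ) δ ∩ Metric.ball 0 η, P ω * e := by
          rw [← Real.norm_eq_abs]
          refine norm_integral_le_of_norm_le ((hPint.mul_const e).integrableOn) ?_
          filter_upwards [ae_restrict_mem hs] with ω hω
          rw [norm_mul, Real.norm_eq_abs, Real.norm_eq_abs, abs_of_nonneg (hPpos ω)]
          refine mul_le_mul_of_nonneg_left (hge ω ?_) (hPpos ω)
          have := hω.2
          rwa [Metric.mem_ball, Real.dist_eq, sub_zero] at this
      _ ≤ ∫ ω, P ω * e := setIntegral_le_integral (hPint.mul_const e)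
          (ae_of_all _ (fun ω => mul_nonneg (hPpos ω) he))
      _ = Real.pi * e := by rw [integral_mul_const, hPtot]
  -- far part
  have hfar : |∫ ω in Ioo (-δ) δ \ Metric.ball 0 η, P ω * (g ω - g 0)| ≤
      ν / η ^ 2 * ∫ ω in Ioo (-δ) δ, |g ω - g 0| := by
    have hs : MeasurableSet (Ioo (-δ) δ \ Metric.ball 0 η) :=
      measurableSet_Ioo.diff measurableSet_ball
    have habs : IntegrableOn (fun ω => |g ω - g 0|) (Ioo (-δ) δ) := hdiff.abs
    calc |∫ ω in Ioo (-δ) δ \ Metric.ball 0 η, P ω * (g ω - g 0)|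
        ≤ ∫ ω in Ioo (-δ) δ \ Metric.ball 0 η, ν / η ^ 2 * |g ω - g 0| := by
          rw [← Real.norm_eq_abs]
          refine norm_integral_le_of_norm_le ((habs.mono_set Set.sdiff_subset).const_mul _) ?_
          filter_upwards [ae_restrict_mem hs] with ω hω
          rw [norm_mul, Real.norm_eq_abs, Real.norm_eq_abs, abs_of_nonneg (hPpos ω)]
          refine mul_le_mul_of_nonneg_right ?_ (abs_nonneg _)
          have hω : η ≤ |ω| := by
            have := hω.2
            rwa [Metric.mem_ball, Real.dist_eq, sub_zero, not_lt] at this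
          have hη2 : η ^ 2 ≤ ω ^ 2 := by
            calc η ^ 2 ≤ |ω| ^ 2 := pow_le_pow_left₀ hη.le hω 2
              _ = ω ^ 2 := sq_abs ω
          calc P ω ≤ ν / ω ^ 2 :=
                div_le_div_of_nonneg_left hν.le (lt_of_lt_of_le (by positivity) hη2) (by nlinarith)
            _ ≤ ν / η ^ 2 := div_le_div_of_nonneg_left hν.le (by positivity) hη2
      _ = ν / η ^ 2 * ∫ ω in Ioo (-δ) δ \ Metric.ball 0 η, |g ω - g 0| := integral_const_mul _ _
      _ ≤ ν / η ^ 2 * ∫ ω in Ioo (-δ) δ, |g ω - g 0| := by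
          refine mul_le_mul_of_nonneg_left ?_ (by positivity)
          exact setIntegral_mono_set habs (ae_of_all _ (fun ω => abs_nonneg _))
            (Eventually.of_forall Set.sdiff_subset)
  -- tail part
  obtain ⟨htail0, htail⟩ := setIntegral_poisson_compl_le hδ hν
  have h3 : ∀ a b c : ℝ, |a + b - c| ≤ |a| + |b| + |c| := fun a b c => by
    calc |a + b - c| = |a + b + -c| := by rw [sub_eq_add_neg]
      _ ≤ |a + b| + |-c| := abs_add_le _ _
      _ ≤ |a| + |b| + |c| := by rw [abs_neg]; linarith [abs_add_le a b]
  -- conclusion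
  rw [hdecomp, ← integral_inter_add_sdiff measurableSet_ball hPd]
  calc |(∫ ω in Ioo (-δ) δ ∩ Metric.ball 0 η, P ω * (g ω - g 0)) +
          (∫ ω in Ioo (-δ) δ \ Metric.ball 0 η, P ω * (g ω - g 0)) -
          g 0 * ∫ ω in (Ioo (-δ) δ)ᶜ, P ω|
      ≤ |∫ ω in Ioo (-δ) δ ∩ Metric.ball 0 η, P ω * (g ω - g 0)| +
          |∫ ω in Ioo (-δ) δ \ Metric.ball 0 η, P ω * (g ω - g 0)| +
          |g 0 * ∫ ω in (Ioo (-δ) δ)ᶜ, P ω| := h3 _ _ _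
    _ ≤ Real.pi * e + ν / η ^ 2 * (∫ ω in Ioo (-δ) δ, |g ω - g 0|) + |g 0| * (2 * ν / δ) := by
          refine add_le_add (add_le_add hnear hfar) ?_
          rw [abs_mul, abs_of_nonneg htail0]
          exact mul_le_mul_of_nonneg_left htail (abs_nonneg _)

/-- **The Poisson kernel is an approximate identity on a window**: for `g` continuous on `(-δ, δ)`
and integrable there, `∫_{(-δ,δ)} ν/(ν²+ω²) g(ω) dω → π g(0)` as `ν ↓ 0`. [folklore] -/
theorem tendsto_setIntegral_poisson_mul {δ : ℝ} (hδ : 0 < δ) {g : ℝ → ℝ}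
    (hgc : ContinuousOn g (Ioo (-δ) δ)) (hgi : IntegrableOn g (Ioo (-δ) δ)) :
    Tendsto (fun ν : ℝ => ∫ ω in Ioo (-δ) δ, ν / (ν ^ 2 + ω ^ 2) * g ω) (𝓝[>] 0)
      (𝓝 (Real.pi * g 0)) := by
  rw [Metric.tendsto_nhds]
  intro ε hε
  have hcont : ContinuousAt g 0 := hgc.continuousAt (Ioo_mem_nhds (by linarith) hδ)
  set e : ℝ := ε / (4 * Real.pi) with he_def
  have he : 0 < e := by positivity
  obtain ⟨η, hη, hηg⟩ := Metric.continuousAt_iff.1 hcont e he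
  have hge : ∀ ω, |ω| < η → |g ω - g 0| ≤ e := fun ω hω => by
    have h1 : dist ω 0 < η := by rwa [Real.dist_eq, sub_zero]
    have h2 := hηg h1
    rw [Real.dist_eq] at h2
    exact h2.le
  set K : ℝ := ∫ ω in Ioo (-δ) δ, |g ω - g 0| with hK_def
  have hlin : Tendsto (fun ν : ℝ => ν / η ^ 2 * K + |g 0| * (2 * ν / δ)) (𝓝[>] 0) (𝓝 0) := by
    have h : Tendsto (fun ν : ℝ => ν / η ^ 2 * K + |g 0| * (2 * ν / δ)) (𝓝 0)
        (𝓝 (0 / η ^ 2 * K + |g 0| * (2 * 0 / δ))) :=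
      (Continuous.tendsto (by fun_prop) 0)
    simp only [zero_div, zero_mul, mul_zero, add_zero] at h
    exact h.mono_left nhdsWithin_le_nhds
  have hev : ∀ᶠ ν in 𝓝[>] (0:ℝ), ν / η ^ 2 * K + |g 0| * (2 * ν / δ) < ε / 2 :=
    hlin (Iio_mem_nhds (by positivity))
  filter_upwards [hev, self_mem_nhdsWithin] with ν hν hνpos
  rw [Real.dist_eq]
  calc |(∫ ω in Ioo (-δ) δ, ν / (ν ^ 2 + ω ^ 2) * g ω) - Real.pi * g 0|
      ≤ Real.pi * e + ν / η ^ 2 * K + |g 0| * (2 * ν / δ) :=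
        abs_setIntegral_poisson_mul_sub_le hδ hη hνpos he.le hgi hge
    _ < ε := by
        have h1 : Real.pi * e = ε / 4 := by
          rw [he_def]; field_simp
        linarith

/-! ### 5. The route statement -/

/-- **Item `stmt-AtomisticToContinuum-12598` (`EmbeddedDrudeMourre.AbelOfSpectralDensity`).**
If `σ` is a finite measure on `ℝ`, `C(t) = ∫ cos(ωt) dσ(ω)`, and on `(-δ, δ)` the measure `σ` is
Lebesgue measure with a continuous non-negative density `g`, then
`∫_{t>0} e^{-νt} C(t) dt → π g(0)` as `ν ↓ 0`. [folklore] -/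
theorem abelOfSpectralDensity_proof :
    Summit.AtomisticToContinuum.FouriersLaw.Theses.EmbeddedDrudeMourre.AbelOfSpectralDensity := by
  unfold Summit.AtomisticToContinuum.FouriersLaw.Theses.EmbeddedDrudeMourre.AbelOfSpectralDensity
  intro σ C δ g hσfin hδ hC hgc hg0 hσ
  -- the density and the integrability of `g` on the window
  have hgm : AEMeasurable g (volume.restrict (Ioo (-δ) δ)) :=
    (hgc.aestronglyMeasurable measurableSet_Ioo).aemeasurable
  have hgi : IntegrableOn g (Ioo (-δ) δ) := integrableOn_of_restrict_eq_withDensity hgc hg0 hσ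
  -- integrability of the Poisson kernel against `σ`
  have hPint : ∀ ν : ℝ, 0 < ν → Integrable (fun ω : ℝ => ν / (ν ^ 2 + ω ^ 2)) σ := by
    intro ν hν
    refine (integrable_const (1 / ν)).mono' (Continuous.aestronglyMeasurable ?_)
      (ae_of_all _ (fun ω => ?_))
    · exact continuous_const.div (by fun_prop) (fun ω => by positivity)
    · rw [Real.norm_eq_abs, abs_of_nonneg (by positivity), div_le_div_iff₀ (by positivity) hν,
        one_mul]
      nlinarith [sq_nonneg ω]
  -- Step 1 + split, valid for every `ν > 0`
  have hformula : ∀ ν : ℝ, 0 < ν →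
      ∫ t in Ioi (0:ℝ), Real.exp (-(ν * t)) * C t =
        (∫ ω in Ioo (-δ) δ, ν / (ν ^ 2 + ω ^ 2) * g ω) +
          ∫ ω in (Ioo (-δ) δ)ᶜ, ν / (ν ^ 2 + ω ^ 2) ∂σ := by
    intro ν hν
    have hC' : (fun t : ℝ => Real.exp (-(ν * t)) * C t) =
        fun t : ℝ => Real.exp (-(ν * t)) * ∫ ω, Real.cos (ω * t) ∂σ := by
      funext t; rw [hC t]
    rw [hC', integral_exp_neg_mul_cosTransform σ hν, ← integral_add_compl measurableSet_Ioo (hPint ν hν),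
      setIntegral_eq_of_restrict_eq_withDensity hg0 hgm hσ]
  -- Step 2: the two limits
  have hwin := tendsto_setIntegral_poisson_mul hδ hgc hgi
  have htail : Tendsto (fun ν : ℝ => ∫ ω in (Ioo (-δ) δ)ᶜ, ν / (ν ^ 2 + ω ^ 2) ∂σ) (𝓝[>] 0)
      (𝓝 0) := by
    refine squeeze_zero_norm' (a := fun ν : ℝ => ν / δ ^ 2 * σ.real univ) ?_ ?_
    · filter_upwards [self_mem_nhdsWithin] with ν hν
      exact norm_setIntegral_poisson_compl_le σ hδ (le_of_lt hν)
    · have h : Tendsto (fun ν : ℝ => ν / δ ^ 2 * σ.real univ) (𝓝 0)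
          (𝓝 (0 / δ ^ 2 * σ.real univ)) := (Continuous.tendsto (by fun_prop) 0)
      simp only [zero_div, zero_mul] at h
      exact h.mono_left nhdsWithin_le_nhds
  have hlim := hwin.add htail
  rw [add_zero] at hlim
  refine hlim.congr' ?_
  filter_upwards [self_mem_nhdsWithin] with ν hν
  exact (hformula ν hν).symm

/-- The same statement as the support `AbelOfSpectralDensity` of route `LatticeLandauDamping`
(item `stmt-AtomisticToContinuum-12598` is shared verbatim by the two routes; the two route decls
are definitionally equal). [folklore] -/
theorem latticeLandauDamping_abelOfSpectralDensity_proof :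
    Summit.AtomisticToContinuum.FouriersLaw.Theses.LatticeLandauDamping.AbelOfSpectralDensity :=
  abelOfSpectralDensity_proof

end Summit.AtomisticToContinuum.FouriersLaw.Theorems.AbelOfSpectralDensity
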